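import Mathlib.GroupTheory.SchurZassenhaus
import Mathlib.GroupTheory.Commutator.Basic
import HarnessLib

/-!
# Complements of normal subgroups with divisible abelian layers (a Schur–Zassenhaus theorem)
(trunk T-AUTOMORPHIC, G25 AutomorphicL; abstract group theory serving Springer 6.3.5)

The Schur–Zassenhaus theorem of finite group theory (Mathlib:
`Subgroup.exists_right_complement'_of_coprime`) says that a normal subgroup `N ⊴ E` whose order is
prime to its index has a complement, and that all complements are conjugate. The coprimality is
used only through the bijectivity of the power map `x ↦ x ^ [E : N]` on the (abelian sections of
the) normal subgroup. This file proves the theorem in that form, for a possibly **infinite** normal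
subgroup `N` of **finite index** `m`:

* `exists_isComplement'_of_pow_bijective`, `exists_conj_eq_of_isComplement'_of_pow_bijective` —
  the abelian case: if `N` is abelian and `x ↦ x ^ m` is a bijection of `N`, then `N` has a
  complement in `E` and any two complements are conjugate under `N`. The existence proof is
  Mathlib's (the action of `E` on the quotient `N.QuotientDiff` of the left transversals by the
  `diff` relation; `Subgroup.smul_diff'`), with the coprimality replaced by the bijectivity
  hypothesis; conjugacy follows because every complement is the stabiliser of a point of
  `N.QuotientDiff` (`IsComplement'.eq_stabilizer_quotientDiff`) and `N` acts transitively.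
* `IsDivisibleFiltration N m Φ r` — an `E`-normal filtration
  `N = Φ 0 ⊇ Φ 1 ⊇ ⋯ ⊇ Φ r = 1` with abelian layers `Φ i / Φ (i+1)` on which the `m`-th power
  map is bijective (stated inside `E`: `m`-th roots exist modulo the next term, and an element
  whose `m`-th power drops to the next term drops itself).
* `exists_isComplement'_of_isDivisibleFiltration`,
  `exists_conj_eq_of_isDivisibleFiltration` — **the filtered Schur–Zassenhaus theorem**: if
  `[E : N] = m` and `N` admits such a filtration then `N` has a complement and all complements
  are conjugate under `N`. Proof: induction on the length `r` through the quotient `E ⧸ Φ (r-1)`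
  by the last (abelian) layer, exactly as in the classical reduction of Schur–Zassenhaus to the
  abelian case (Rotman, *An Introduction to the Theory of Groups*, Thm 7.39–7.42, pp. 194–195:
  7.39/7.40 the abelian case, 7.41 existence, 7.42 conjugacy when `K` is solvable — the case
  needing no Feit–Thompson).

Application (in `SolvableGroupTori.lean`): for a connected solvable `G ≤ GL n k` with unipotent
part `U`, the finite subgroups of the torus `G/U` of order prime to the characteristic lift to
`G`, uniquely up to `U`-conjugacy, because `U` is filtered by the flag-lowering subgroups with
vector-group layers (Springer 6.3.5: existence and conjugacy of maximal tori).

## Mathlib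

Everything about complements and transversals is Mathlib's (`Subgroup.IsComplement'`,
`Subgroup.LeftTransversal`, `Subgroup.QuotientDiff` with its `MulAction`, `Subgroup.smul_diff'`,
`Subgroup.isComplement'_stabilizer`, `MulAction.stabilizer_smul_eq_stabilizer_map_conj`,
quotient groups). Mathlib's Schur–Zassenhaus file treats finite groups only
(`Nat.Coprime (Nat.card N) N.index`, which for infinite `N` forces `N.index = 1`); the statements
below are the versions for infinite `N`, which Mathlib does not have (searched `SchurZassenhaus`,
`complement` + `divisible`, `QuotientDiff`).

## References

* [Rotman1995] J. J. Rotman, *An Introduction to the Theory of Groups*, 4th ed., GTM 148,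
  Springer (1995), Thm 7.39–7.42, pp. 194–195 (Schur–Zassenhaus for finite groups).
* T. A. Springer, *Linear Algebraic Groups*, 2nd ed., Birkhäuser (1998), 6.3.5 (the consumer).
-/

namespace Literature.NumberTheory.Automorphic

open Subgroup Subgroup.leftTransversals MulOpposite MulAction
open scoped Pointwise

universe u

/-! ### The abelian case: Mathlib's proof with bijectivity of the power map -/

section Abelian

variable {G : Type*} [Group G] {H : Subgroup G} [IsMulCommutative H] [H.FiniteIndex] [H.Normal]

open scoped IsMulCommutative in
/-- If `h ↦ h ^ [G : H]` is injective on the abelian normal subgroup `H`, then `H` acts freely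
on `H.QuotientDiff` (Mathlib's `Subgroup.eq_one_of_smul_eq_one` with coprimality replaced by
injectivity). [folklore] -/
theorem eq_one_of_smul_quotientDiff_eq (hpow : Function.Injective fun h : H => h ^ H.index)
    (α : H.QuotientDiff) (h : H) (hα : h • α = α) : h = 1 :=
  Quotient.inductionOn' α (fun α hα =>
    hpow <|
      calc
        h ^ H.index = diff (MonoidHom.id H) (op ((h⁻¹ : H) : G) • α) α := by
          rw [← diff_inv, smul_diff', diff_self, one_mul, inv_pow, inv_inv]
        _ = 1 ^ H.index := (Quotient.exact' hα).trans (one_pow H.index).symm) hα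

open scoped IsMulCommutative in
/-- If `h ↦ h ^ [G : H]` is surjective on the abelian normal subgroup `H`, then `H` acts
transitively on `H.QuotientDiff` (Mathlib's `Subgroup.exists_smul_eq` with coprimality replaced
by surjectivity). [folklore] -/
theorem exists_smul_quotientDiff_eq (hpow : Function.Surjective fun h : H => h ^ H.index)
    (α β : H.QuotientDiff) : ∃ h : H, h • α = β :=
  Quotient.inductionOn' α
    (Quotient.inductionOn' β fun β α => by
      obtain ⟨c, hc⟩ := hpow (diff (MonoidHom.id H) β α)
      refine Exists.imp (fun _ => Quotient.sound') ⟨c, ?_⟩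
      refine (diff_inv _ _ _).symm.trans (inv_eq_one.mpr ?_)
      refine (smul_diff' β α c⁻¹).trans ?_
      rw [inv_pow]
      exact mul_inv_eq_one.mpr hc.symm)

/-- **Existence of complements, abelian case**: if `H ⊴ G` is abelian of finite index `m` and
`h ↦ h ^ m` is a bijection of `H`, the stabiliser of any point of `H.QuotientDiff` is a
complement of `H` (Mathlib's `Subgroup.isComplement'_stabilizer_of_coprime`, generalised).
[folklore] -/
theorem isComplement'_stabilizer_of_pow_bijective
    (hpow : Function.Bijective fun h : H => h ^ H.index) (α : H.QuotientDiff) :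
    IsComplement' H (stabilizer G α) :=
  isComplement'_stabilizer α (eq_one_of_smul_quotientDiff_eq hpow.1 α)
    fun g => exists_smul_quotientDiff_eq hpow.2 (g • α) α

/-- **Schur–Zassenhaus, abelian case with a divisibility hypothesis**: an abelian normal
subgroup `H` of finite index `m` on which `h ↦ h ^ m` is bijective (e.g. `H` a vector group over
a field of characteristic prime to `m`, or a uniquely divisible group) has a complement (Rotman
Thm 7.39 is the case of finite `H` of order prime to `m`).
[cite: Rotman1995, Thm 7.39 (p. 194), infinite-`K` form] -/
theorem exists_isComplement'_of_pow_bijective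
    (hpow : Function.Bijective fun h : H => h ^ H.index) :
    ∃ K : Subgroup G, IsComplement' H K :=
  ⟨_, isComplement'_stabilizer_of_pow_bijective hpow default⟩

/-- Every complement `K` of the abelian normal subgroup `H` is the stabiliser of a point of
`H.QuotientDiff`, namely of the class of the transversal `K` (granted that `H` acts freely,
i.e. that `h ↦ h ^ m` is injective). [folklore] -/
theorem exists_eq_stabilizer_of_isComplement'
    (hpow : Function.Injective fun h : H => h ^ H.index) {K : Subgroup G}
    (hK : IsComplement' H K) : ∃ α : H.QuotientDiff, K = stabilizer G α := by
  -- `K` as a left transversal of `H`, and its class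
  let T : H.LeftTransversal := ⟨(K : Set G), isComplement'_def.1 hK.symm⟩
  let αK : H.QuotientDiff := Quotient.mk'' T
  -- `k • [K] = [K k⁻¹] = [K]`
  have hKstab : ∀ x ∈ K, x ∈ stabilizer G αK := by
    intro x hx
    rw [mem_stabilizer_iff]
    change (Quotient.mk'' (op x⁻¹ • T) : H.QuotientDiff) = Quotient.mk'' T
    congr 1
    apply Subtype.ext
    change op x⁻¹ • (K : Set G) = K
    ext y
    rw [Set.mem_smul_set]
    constructor
    · rintro ⟨z, hz, rfl⟩
      rw [op_smul_eq_mul]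
      exact K.mul_mem hz (K.inv_mem hx)
    · intro hy
      exact ⟨y * x, K.mul_mem hy hx, by rw [op_smul_eq_mul, mul_inv_cancel_right]⟩
  refine ⟨αK, le_antisymm hKstab ?_⟩
  -- a stabilising `s = h k` has `h` stabilising, so `h = 1`
  intro s hs
  obtain ⟨⟨h, κ⟩, rfl⟩ := hK.2 s
  have hκ : ((κ : G) : G) ∈ stabilizer G αK := hKstab _ κ.2
  have hh : (h : G) ∈ stabilizer G αK := by
    have := (stabilizer G αK).mul_mem hs ((stabilizer G αK).inv_mem hκ)
    simpa using this
  rw [mem_stabilizer_iff] at hh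
  have h1 : h = 1 := eq_one_of_smul_quotientDiff_eq hpow _ h hh
  change (h : G) * (κ : G) ∈ K
  rw [h1, OneMemClass.coe_one, one_mul]
  exact κ.2

/-- **Conjugacy of complements, abelian case**: if `H ⊴ G` is abelian of finite index `m` and
`h ↦ h ^ m` is a bijection of `H`, any two complements of `H` are conjugate by an element of
`H` (the `H¹`-half of Schur–Zassenhaus; Rotman Thm 7.40 is the case of finite `H` of order
prime to `m`). [cite: Rotman1995, Thm 7.40 (p. 195), infinite-`K` form] -/
theorem exists_conj_eq_of_isComplement'_of_pow_bijective
    (hpow : Function.Bijective fun h : H => h ^ H.index) {K K' : Subgroup G}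
    (hK : IsComplement' H K) (hK' : IsComplement' H K') :
    ∃ h ∈ H, K' = K.map (MulAut.conj h).toMonoidHom := by
  obtain ⟨α, rfl⟩ := exists_eq_stabilizer_of_isComplement' hpow.1 hK
  obtain ⟨β, rfl⟩ := exists_eq_stabilizer_of_isComplement' hpow.1 hK'
  obtain ⟨h, rfl⟩ := exists_smul_quotientDiff_eq hpow.2 α β
  exact ⟨h, h.2, stabilizer_smul_eq_stabilizer_map_conj (h : G) α⟩

end Abelian

/-! ### Complements are preserved by conjugation and detected by `N K = E`, `N ∩ K = 1` -/

section General

variable {E : Type*} [Group E] {N : Subgroup E}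

/-- A conjugate of a complement of a normal subgroup is a complement. [folklore] -/
theorem isComplement'_map_conj [N.Normal] {K : Subgroup E} (hK : IsComplement' N K) (x : E) :
    IsComplement' N (K.map (MulAut.conj x).toMonoidHom) := by
  refine isComplement'_of_disjoint_and_mul_eq_univ ?_ ?_
  · rw [disjoint_iff_inf_le]
    intro y hy
    obtain ⟨hyN, hyK⟩ := mem_inf.1 hy
    obtain ⟨z, hz, rfl⟩ := hyK
    simp only [MulEquiv.coe_toMonoidHom, MulAut.conj_apply] at hyN ⊢
    have hz' : z ∈ N := by
      have := (inferInstance : N.Normal).conj_mem _ hyN x⁻¹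
      simpa [mul_assoc] using this
    have hdisj := hK.disjoint
    rw [disjoint_iff_inf_le] at hdisj
    have h1 : z = 1 := hdisj (mem_inf.2 ⟨hz', hz⟩)
    rw [h1, mul_one, mul_inv_cancel]
    exact one_mem _
  · refine Set.eq_univ_of_forall fun g => ?_
    obtain ⟨⟨n, κ⟩, h⟩ := hK.2 (x⁻¹ * g * x)
    refine Set.mem_mul.2 ⟨x * n * x⁻¹, (inferInstance : N.Normal).conj_mem _ n.2 x,
      x * κ * x⁻¹, ⟨κ, κ.2, by simp⟩, ?_⟩
    change (n : E) * (κ : E) = x⁻¹ * g * x at h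
    calc x * ↑n * x⁻¹ * (x * ↑κ * x⁻¹) = x * (↑n * ↑κ) * x⁻¹ := by group
      _ = g := by rw [h]; group

end General

/-! ### Divisible filtrations and the filtered Schur–Zassenhaus theorem -/

section Filtered

variable {E : Type u} [Group E]

/-- An `E`-normal filtration `N = Φ 0 ⊇ Φ 1 ⊇ ⋯ ⊇ Φ r = 1` of `N` with abelian layers
`Φ i / Φ (i+1)` on which the `m`-th power map is bijective: `m`-th roots exist modulo the next
term (`div`) and an element of `Φ i` whose `m`-th power lies in `Φ (i+1)` lies in `Φ (i+1)`
(`torsionFree`). Example: the unipotent part of a connected solvable matrix group filtered by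
the flag-lowering subgroups, `m` prime to the characteristic. [folklore] -/
structure IsDivisibleFiltration (N : Subgroup E) (m : ℕ) (Φ : ℕ → Subgroup E) (r : ℕ) :
    Prop where
  zero : Φ 0 = N
  last : Φ r = ⊥
  le_succ : ∀ i, Φ (i + 1) ≤ Φ i
  normal : ∀ i, (Φ i).Normal
  commutator_le : ∀ i, ⁅Φ i, Φ i⁆ ≤ Φ (i + 1)
  div : ∀ i, ∀ x ∈ Φ i, ∃ y ∈ Φ i, x⁻¹ * y ^ m ∈ Φ (i + 1)
  torsionFree : ∀ i, ∀ y ∈ Φ i, y ^ m ∈ Φ (i + 1) → y ∈ Φ (i + 1)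

namespace IsDivisibleFiltration

variable {N : Subgroup E} {m : ℕ} {Φ : ℕ → Subgroup E} {r : ℕ}

/-- The filtration is antitone. [folklore] -/
theorem antitone (h : IsDivisibleFiltration N m Φ r) : Antitone Φ :=
  antitone_nat_of_succ_le h.le_succ

/-- All terms lie in `N`. [folklore] -/
theorem le_zero (h : IsDivisibleFiltration N m Φ r) (i : ℕ) : Φ i ≤ N :=
  h.zero ▸ h.antitone (Nat.zero_le i)

/-- A filtration of length `0` is of the trivial subgroup. [folklore] -/
theorem eq_bot_of_zero (h : IsDivisibleFiltration N m Φ 0) : N = ⊥ :=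
  h.zero ▸ h.last

/-- The image of a divisible filtration of length `r + 1` in `E ⧸ Φ r` (the quotient by the last
layer) is a divisible filtration of length `r`. [folklore] -/
theorem map_mk (h : IsDivisibleFiltration N m Φ (r + 1)) [(Φ r).Normal] :
    IsDivisibleFiltration (N.map (QuotientGroup.mk' (Φ r))) m
      (fun i => (Φ i).map (QuotientGroup.mk' (Φ r))) r := by
  set π := QuotientGroup.mk' (Φ r) with hπ
  have hπsurj : Function.Surjective π := QuotientGroup.mk'_surjective _
  refine ⟨by rw [h.zero], ?_, fun i => map_mono (h.le_succ i), fun i => ?_, fun i => ?_,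
    fun i => ?_, fun i => ?_⟩
  · -- `Φ r ↦ 1`
    rw [Subgroup.map_eq_bot_iff, hπ, QuotientGroup.ker_mk']
  · haveI := h.normal i
    exact Normal.map inferInstance π hπsurj
  · rw [← map_commutator]
    exact map_mono (h.commutator_le i)
  · rintro _ ⟨x, hx, rfl⟩
    obtain ⟨y, hy, hxy⟩ := h.div i x hx
    exact ⟨π y, ⟨y, hy, rfl⟩, ⟨x⁻¹ * y ^ m, hxy, by simp⟩⟩
  · rintro _ ⟨y, hy, rfl⟩ hym
    -- `π (y ^ m) ∈ π (Φ (i+1))`: `y ^ m ∈ Φ (i+1) · Φ r`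
    rw [← map_pow] at hym
    obtain ⟨z, hz, hzy⟩ := hym
    have hker : z⁻¹ * y ^ m ∈ Φ r := by
      rw [← QuotientGroup.ker_mk' (Φ r), MonoidHom.mem_ker, map_mul, map_inv, ← hπ, hzy,
        inv_mul_cancel]
    by_cases hi : i + 1 ≤ r
    · have hyr : y ^ m ∈ Φ (i + 1) := by
        have := (Φ (i + 1)).mul_mem hz (h.antitone hi hker)
        simpa using this
      exact ⟨y, h.torsionFree i y hy hyr, rfl⟩
    · -- `i + 1 > r`: `Φ (i+1) ⊆ Φ r` maps to `1`, and so does `y ∈ Φ i ⊆ Φ r`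
      push Not at hi
      have hyr : y ∈ Φ r := h.antitone (by omega) hy
      have h1 : π y = 1 := by
        rw [hπ, ← MonoidHom.mem_ker, QuotientGroup.ker_mk']
        exact hyr
      rw [h1]
      exact one_mem _

/-- On the last layer `A = Φ r` of a filtration of length `r + 1` the `m`-th power map is a
bijection. [folklore] -/
theorem pow_bijective_last (h : IsDivisibleFiltration N m Φ (r + 1)) :
    Function.Bijective fun a : ↥(Φ r) => a ^ m := by
  constructor
  · -- injective: the layer is abelian, and `a ^ m = 1 → a = 1`
    have hcomm : ∀ a b : ↥(Φ r), a * b = b * a := by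
      intro a b
      have hc : (a : E) * b * (a : E)⁻¹ * (b : E)⁻¹ ∈ Φ (r + 1) :=
        h.commutator_le r (commutator_mem_commutator a.2 b.2)
      rw [h.last, mem_bot] at hc
      apply Subtype.ext
      change (a : E) * b = b * a
      calc (a : E) * b = ((a : E) * b * (a : E)⁻¹ * (b : E)⁻¹) * (b * a) := by group
        _ = b * a := by rw [hc, one_mul]
    intro a b hab
    change a ^ m = b ^ m at hab
    have hq : (a * b⁻¹) ^ m = 1 := by
      have hc : Commute a b⁻¹ := hcomm a b⁻¹
      rw [hc.mul_pow m, inv_pow, hab, mul_inv_cancel]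
    have hqE : ((a * b⁻¹ : ↥(Φ r)) : E) ^ m = 1 := by
      have := congrArg Subtype.val hq
      simpa using this
    have hmem : ((a * b⁻¹ : ↥(Φ r)) : E) ∈ Φ (r + 1) :=
      h.torsionFree r _ (a * b⁻¹).2 (by rw [hqE]; exact one_mem _)
    rw [h.last, mem_bot] at hmem
    have : a * b⁻¹ = 1 := Subtype.ext hmem
    exact mul_inv_eq_one.1 this
  · intro x
    obtain ⟨y, hy, hxy⟩ := h.div r x x.2
    rw [h.last, mem_bot] at hxy
    refine ⟨⟨y, hy⟩, Subtype.ext ?_⟩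
    change y ^ m = x
    calc y ^ m = (x : E) * ((x : E)⁻¹ * y ^ m) := by group
      _ = x := by rw [hxy, mul_one]

/-- The last layer of a divisible filtration is abelian. [folklore] -/
theorem isMulCommutative_last (h : IsDivisibleFiltration N m Φ (r + 1)) :
    IsMulCommutative ↥(Φ r) := by
  refine ⟨⟨fun a b => Subtype.ext ?_⟩⟩
  have hc : (a : E) * b * (a : E)⁻¹ * (b : E)⁻¹ ∈ Φ (r + 1) :=
    h.commutator_le r (commutator_mem_commutator a.2 b.2)
  rw [h.last, mem_bot] at hc
  change (a : E) * b = b * a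
  calc (a : E) * b = ((a : E) * b * (a : E)⁻¹ * (b : E)⁻¹) * (b * a) := by group
    _ = b * a := by rw [hc, one_mul]

end IsDivisibleFiltration

/-- Transport of a complement of `A.subgroupOf E₁` inside `E₁` to a complement of `N` in `E`,
where `E₁ ⊇ A` is the preimage of a complement `Q̄` of `N / A` in `E / A` and `A ≤ N`.
[folklore] -/
theorem isComplement'_of_quotient_of_subgroupOf {A : Subgroup E} [A.Normal] {N : Subgroup E}
    (hAN : A ≤ N) {Qbar : Subgroup (E ⧸ A)}
    (hQ : IsComplement' (N.map (QuotientGroup.mk' A)) Qbar) {E₁ : Subgroup E}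
    (hE₁ : E₁ = Qbar.comap (QuotientGroup.mk' A)) {Q' : Subgroup ↥E₁}
    (hQ' : IsComplement' (A.subgroupOf E₁) Q') :
    IsComplement' N (Q'.map E₁.subtype) := by
  subst hE₁
  refine isComplement'_of_disjoint_and_mul_eq_univ ?_ ?_
  · rw [disjoint_iff_inf_le]
    rintro x ⟨hxN, ⟨q, hq, rfl⟩⟩
    -- `π q ∈ N̄ ∩ Q̄ = 1`, so `q ∈ A ∩ Q' = 1`
    have h1 : QuotientGroup.mk' A (q : E) ∈ N.map (QuotientGroup.mk' A) ⊓ Qbar :=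
      mem_inf.2 ⟨⟨_, hxN, rfl⟩, q.2⟩
    have hdisj := hQ.disjoint
    rw [disjoint_iff_inf_le] at hdisj
    have h2 : QuotientGroup.mk' A (q : E) = 1 := hdisj h1
    have hqA : (q : E) ∈ A := by
      rw [← MonoidHom.mem_ker, QuotientGroup.ker_mk'] at h2
      exact h2
    have hq' : q ∈ A.subgroupOf (Qbar.comap (QuotientGroup.mk' A)) ⊓ Q' :=
      mem_inf.2 ⟨hqA, hq⟩
    have hdisj' := hQ'.disjoint
    rw [disjoint_iff_inf_le] at hdisj'
    have : q = 1 := hdisj' hq'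
    simp [this]
  · refine Set.eq_univ_of_forall fun g => ?_
    -- `π g = n̄ q̄`
    obtain ⟨⟨nbar, qbar⟩, hg⟩ := hQ.2 (QuotientGroup.mk' A g)
    obtain ⟨n, hn, hnbar⟩ := nbar.2
    change (nbar : E ⧸ A) * (qbar : E ⧸ A) = QuotientGroup.mk' A g at hg
    have he₁ : n⁻¹ * g ∈ Qbar.comap (QuotientGroup.mk' A) := by
      change QuotientGroup.mk' A (n⁻¹ * g) ∈ Qbar
      rw [map_mul, map_inv, hnbar, ← hg, inv_mul_cancel_left]
      exact qbar.2
    -- decompose `n⁻¹ g = a q` in `E₁`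
    obtain ⟨⟨a, q⟩, haq⟩ := hQ'.2 ⟨n⁻¹ * g, he₁⟩
    have haq' : ((a : ↥(Qbar.comap (QuotientGroup.mk' A))) : E) *
        ((q : ↥(Qbar.comap (QuotientGroup.mk' A))) : E) = n⁻¹ * g := by
      have := congrArg (fun z : ↥(Qbar.comap (QuotientGroup.mk' A)) => (z : E)) haq
      simpa using this
    refine Set.mem_mul.2 ⟨n * ((a : ↥(Qbar.comap (QuotientGroup.mk' A))) : E),
      N.mul_mem hn (hAN a.2), ((q : ↥(Qbar.comap (QuotientGroup.mk' A))) : E),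
      ⟨q, q.2, rfl⟩, ?_⟩
    rw [mul_assoc, haq', mul_inv_cancel_left]

/-- **The filtered Schur–Zassenhaus theorem, existence**: a normal subgroup `N` of finite index
`m` admitting an `E`-normal filtration with abelian layers on which `x ↦ x ^ m` is bijective has
a complement. Induction on the length through `E ⧸ Φ r` and the abelian case
`exists_isComplement'_of_pow_bijective` (Rotman Thm 7.41, the Schur–Zassenhaus lemma, is the
case of a finite normal Hall subgroup, where the reduction to the abelian case goes through a
minimal normal subgroup instead of a given filtration).
[cite: Rotman1995, Thm 7.41 (p. 195), filtered infinite-`K` form] -/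
theorem exists_isComplement'_of_isDivisibleFiltration :
    ∀ (r : ℕ) {E : Type u} [Group E] (N : Subgroup E) [N.Normal] [N.FiniteIndex]
      (Φ : ℕ → Subgroup E), IsDivisibleFiltration N N.index Φ r →
      ∃ K : Subgroup E, IsComplement' N K := by
  intro r
  induction r with
  | zero =>
    intro E _ N _ _ Φ h
    refine ⟨⊤, ?_⟩
    rw [h.eq_bot_of_zero]
    exact isComplement'_bot_top
  | succ r ih =>
    intro E _ N _ _ Φ h
    set A := Φ r with hA
    haveI : A.Normal := h.normal r
    set π := QuotientGroup.mk' A with hπ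
    have hπsurj : Function.Surjective π := QuotientGroup.mk'_surjective _
    have hAN : A ≤ N := h.le_zero r
    -- the quotient data
    set Nbar := N.map π with hNbar
    haveI : Nbar.Normal := Normal.map inferInstance π hπsurj
    have hidx : Nbar.index = N.index :=
      index_map_eq N hπsurj (by rw [hπ, QuotientGroup.ker_mk']; exact hAN)
    haveI : Nbar.FiniteIndex := ⟨by rw [hidx]; exact FiniteIndex.index_ne_zero⟩
    have hbar : IsDivisibleFiltration Nbar Nbar.index (fun i => (Φ i).map π) r := by
      rw [hidx]; exact h.map_mk
    obtain ⟨Qbar, hQbar⟩ := ih Nbar (fun i => (Φ i).map π) hbar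
    -- inside `E₁ = π⁻¹ Q̄`: `A` is abelian normal of index `m` with bijective `m`-th power
    set E₁ := Qbar.comap π with hE₁
    set A₁ := A.subgroupOf E₁ with hA₁
    haveI : A₁.Normal := by rw [hA₁]; infer_instance
    haveI hAc : IsMulCommutative ↥A := h.isMulCommutative_last
    haveI : IsMulCommutative ↥A₁ :=
      ⟨⟨fun a b => Subtype.ext (Subtype.ext (by
        have := congrArg Subtype.val
          (hAc.is_comm.comm ⟨((a : ↥E₁) : E), a.2⟩ ⟨((b : ↥E₁) : E), b.2⟩)
        simpa using this))⟩⟩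
    have hAE₁ : A ≤ E₁ := by
      intro a ha
      rw [hE₁, mem_comap]
      have h1 : π a = 1 := by rw [hπ, ← MonoidHom.mem_ker, QuotientGroup.ker_mk']; exact ha
      rw [h1]
      exact one_mem _
    have hidx₁ : A₁.index = N.index := by
      rw [hA₁, ← relIndex]
      calc A.relIndex E₁ = ((⊥ : Subgroup (E ⧸ A)).comap π).relIndex E₁ := by
              rw [MonoidHom.comap_bot, hπ, QuotientGroup.ker_mk']
        _ = (⊥ : Subgroup (E ⧸ A)).relIndex (E₁.map π) := by rw [relIndex_comap]
        _ = Nat.card ↥(E₁.map π) := by rw [relIndex_bot_left]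
        _ = Nat.card ↥Qbar := by rw [hE₁, map_comap_eq_self_of_surjective hπsurj]
        _ = Nbar.index := hQbar.symm.index_eq_card.symm
        _ = N.index := hidx
    haveI : A₁.FiniteIndex := ⟨by rw [hidx₁]; exact FiniteIndex.index_ne_zero⟩
    have hpowA := h.pow_bijective_last
    have hpow₁ : Function.Bijective fun a : ↥A₁ => a ^ A₁.index := by
      rw [hidx₁]
      -- transport along `A₁ ≃ A`
      let e : ↥A₁ ≃ ↥A := (subgroupOfEquivOfLe hAE₁).toEquiv
      have he : ∀ a : ↥A₁, e (a ^ N.index) = (e a) ^ N.index := fun a => by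
        simp [e]
      have : (fun a : ↥A₁ => a ^ N.index) = e.symm ∘ (fun a : ↥A => a ^ N.index) ∘ e := by
        funext a
        simp only [Function.comp_apply]
        rw [← he, Equiv.symm_apply_apply]
      rw [this]
      exact e.symm.bijective.comp (hpowA.comp e.bijective)
    obtain ⟨Q', hQ'⟩ := exists_isComplement'_of_pow_bijective (H := A₁) hpow₁
    exact ⟨_, isComplement'_of_quotient_of_subgroupOf hAN hQbar hE₁ hQ'⟩

/-- **The filtered Schur–Zassenhaus theorem, conjugacy**: under the hypotheses of
`exists_isComplement'_of_isDivisibleFiltration`, any two complements of `N` are conjugate by an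
element of `N` (Rotman Thm 7.42, case "`K` solvable", is the finite normal Hall subgroup
version, by the same induction through `K' < K`).
[cite: Rotman1995, Thm 7.42 (p. 195), filtered infinite-`K` form] -/
theorem exists_conj_eq_of_isDivisibleFiltration :
    ∀ (r : ℕ) {E : Type u} [Group E] (N : Subgroup E) [N.Normal] [N.FiniteIndex]
      (Φ : ℕ → Subgroup E), IsDivisibleFiltration N N.index Φ r →
      ∀ {K K' : Subgroup E}, IsComplement' N K → IsComplement' N K' →
      ∃ x ∈ N, K' = K.map (MulAut.conj x).toMonoidHom := by
  intro r
  induction r with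
  | zero =>
    intro E _ N _ _ Φ h K K' hK hK'
    have hN := h.eq_bot_of_zero
    subst hN
    rw [isComplement'_bot_left] at hK hK'
    subst hK; subst hK'
    refine ⟨1, one_mem _, ?_⟩
    simp
  | succ r ih =>
    intro E _ N _ _ Φ h K K' hK hK'
    set A := Φ r with hA
    haveI : A.Normal := h.normal r
    set π := QuotientGroup.mk' A with hπ
    have hπsurj : Function.Surjective π := QuotientGroup.mk'_surjective _
    have hAN : A ≤ N := h.le_zero r
    set Nbar := N.map π with hNbar
    haveI : Nbar.Normal := Normal.map inferInstance π hπsurj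
    have hidx : Nbar.index = N.index :=
      index_map_eq N hπsurj (by rw [hπ, QuotientGroup.ker_mk']; exact hAN)
    haveI : Nbar.FiniteIndex := ⟨by rw [hidx]; exact FiniteIndex.index_ne_zero⟩
    have hbar : IsDivisibleFiltration Nbar Nbar.index (fun i => (Φ i).map π) r := by
      rw [hidx]; exact h.map_mk
    -- images of complements are complements
    have himg : ∀ {L : Subgroup E}, IsComplement' N L → IsComplement' Nbar (L.map π) := by
      intro L hL
      refine isComplement'_of_disjoint_and_mul_eq_univ ?_ ?_
      · rw [disjoint_iff_inf_le]
        rintro _ ⟨⟨n, hn, hnl⟩, ⟨l, hl, rfl⟩⟩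
        -- `π n = π l`: `n⁻¹ l ∈ A ≤ N`, so `l ∈ N ∩ L = 1`
        have hnl' : n⁻¹ * l ∈ A := by
          rw [← QuotientGroup.ker_mk' A, MonoidHom.mem_ker, map_mul, map_inv, ← hπ, hnl,
            inv_mul_cancel]
        have hlN : l ∈ N := by
          have := N.mul_mem hn (hAN hnl')
          simpa using this
        have hdisj := hL.disjoint
        rw [disjoint_iff_inf_le] at hdisj
        have : l = 1 := hdisj ⟨hlN, hl⟩
        rw [this, map_one]
        exact one_mem _
      · refine Set.eq_univ_of_forall fun gbar => ?_
        obtain ⟨g, rfl⟩ := hπsurj gbar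
        obtain ⟨⟨n, l⟩, hg⟩ := hL.2 g
        change (n : E) * (l : E) = g at hg
        exact Set.mem_mul.2 ⟨π n, ⟨n, n.2, rfl⟩, π l, ⟨l, l.2, rfl⟩, by rw [← map_mul, hg]⟩
    obtain ⟨xbar, hxbar, hconj⟩ := ih Nbar (fun i => (Φ i).map π) hbar (himg hK) (himg hK')
    obtain ⟨x, hx, rfl⟩ := hxbar
    -- replace `K` by `x K x⁻¹`, whose image is the image of `K'`
    set K₁ := K.map (MulAut.conj x).toMonoidHom with hK₁
    have hK₁c : IsComplement' N K₁ := isComplement'_map_conj hK x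
    have hK₁img : K₁.map π = K'.map π := by
      rw [hconj, hK₁, map_map, map_map]
      congr 1
    -- both `K₁` and `K'` lie in `E₁ = π⁻¹ (π K')`, where they complement `A`
    set E₁ := (K'.map π).comap π with hE₁
    set A₁ := A.subgroupOf E₁ with hA₁
    haveI : A₁.Normal := by rw [hA₁]; infer_instance
    haveI hAc : IsMulCommutative ↥A := h.isMulCommutative_last
    haveI : IsMulCommutative ↥A₁ :=
      ⟨⟨fun a b => Subtype.ext (Subtype.ext (by
        have := congrArg Subtype.val
          (hAc.is_comm.comm ⟨((a : ↥E₁) : E), a.2⟩ ⟨((b : ↥E₁) : E), b.2⟩)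
        simpa using this))⟩⟩
    have hQbar : IsComplement' Nbar (K'.map π) := himg hK'
    have hidx₁ : A₁.index = N.index := by
      rw [hA₁, ← relIndex]
      calc A.relIndex E₁ = ((⊥ : Subgroup (E ⧸ A)).comap π).relIndex E₁ := by
              rw [MonoidHom.comap_bot, hπ, QuotientGroup.ker_mk']
        _ = (⊥ : Subgroup (E ⧸ A)).relIndex (E₁.map π) := by rw [relIndex_comap]
        _ = Nat.card ↥(E₁.map π) := by rw [relIndex_bot_left]
        _ = Nat.card ↥(K'.map π) := by rw [hE₁, map_comap_eq_self_of_surjective hπsurj]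
        _ = Nbar.index := hQbar.symm.index_eq_card.symm
        _ = N.index := hidx
    haveI : A₁.FiniteIndex := ⟨by rw [hidx₁]; exact FiniteIndex.index_ne_zero⟩
    have hAE₁ : A ≤ E₁ := by
      intro a ha
      rw [hE₁, mem_comap]
      have h1 : π a = 1 := by rw [hπ, ← MonoidHom.mem_ker, QuotientGroup.ker_mk']; exact ha
      rw [h1]
      exact one_mem _
    have hpowA := h.pow_bijective_last
    have hpow₁ : Function.Bijective fun a : ↥A₁ => a ^ A₁.index := by
      rw [hidx₁]
      let e : ↥A₁ ≃ ↥A := (subgroupOfEquivOfLe hAE₁).toEquiv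
      have he : ∀ a : ↥A₁, e (a ^ N.index) = (e a) ^ N.index := fun a => by simp [e]
      have : (fun a : ↥A₁ => a ^ N.index) = e.symm ∘ (fun a : ↥A => a ^ N.index) ∘ e := by
        funext a
        simp only [Function.comp_apply]
        rw [← he, Equiv.symm_apply_apply]
      rw [this]
      exact e.symm.bijective.comp (hpowA.comp e.bijective)
    -- complements of `A₁` in `E₁` from complements `L ≤ E₁` of `N` in `E` with `π L = π K'`
    have hsub : ∀ {L : Subgroup E}, IsComplement' N L → L.map π = K'.map π →
        IsComplement' A₁ (L.subgroupOf E₁) := by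
      intro L hL hLimg
      have hLE₁ : L ≤ E₁ := by
        rw [hE₁, ← hLimg]
        exact le_comap_map _ _
      refine isComplement'_of_disjoint_and_mul_eq_univ ?_ ?_
      · rw [disjoint_iff_inf_le]
        rintro y ⟨hyA, hyL⟩
        have hdisj := hL.disjoint
        rw [disjoint_iff_inf_le] at hdisj
        have : (y : E) = 1 := hdisj ⟨hAN hyA, hyL⟩
        exact Subtype.ext this
      · refine Set.eq_univ_of_forall fun e => ?_
        -- `π e ∈ π L`: `e = l a = (l a l⁻¹) l`
        have he : π (e : E) ∈ L.map π := hLimg ▸ e.2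
        obtain ⟨l, hl, hle⟩ := he
        have ha : l⁻¹ * (e : E) ∈ A := by
          rw [← QuotientGroup.ker_mk' A, MonoidHom.mem_ker, map_mul, map_inv, ← hπ, hle,
            inv_mul_cancel]
        have ha' : (e : E) * l⁻¹ ∈ A := by
          have := (inferInstance : A.Normal).conj_mem _ ha l
          simpa [mul_assoc] using this
        have hlE₁ : l ∈ E₁ := hLE₁ hl
        refine Set.mem_mul.2 ⟨⟨(e : E) * l⁻¹, E₁.mul_mem e.2 (E₁.inv_mem hlE₁)⟩, ha',
          ⟨l, hlE₁⟩, hl, Subtype.ext ?_⟩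
        change (e : E) * l⁻¹ * l = e
        rw [inv_mul_cancel_right]
    obtain ⟨a, haA₁, hconj₁⟩ :=
      exists_conj_eq_of_isComplement'_of_pow_bijective hpow₁ (hsub hK₁c hK₁img) (hsub hK' rfl)
    -- assemble: `K' = a (x K x⁻¹) a⁻¹`
    refine ⟨(a : E) * x, N.mul_mem (hAN haA₁) hx, ?_⟩
    have hK'E₁ : K' ≤ E₁ := le_comap_map _ _
    have hK₁E₁ : K₁ ≤ E₁ := by rw [hE₁, ← hK₁img]; exact le_comap_map _ _
    calc K' = (K'.subgroupOf E₁).map E₁.subtype := (map_subgroupOf_eq_of_le hK'E₁).symm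
      _ = ((K₁.subgroupOf E₁).map (MulAut.conj a).toMonoidHom).map E₁.subtype := by
          rw [hconj₁]
      _ = K₁.map (MulAut.conj (a : E)).toMonoidHom := by
          ext y
          simp only [mem_map, mem_subgroupOf, MulEquiv.coe_toMonoidHom, MulAut.conj_apply,
            coe_subtype]
          constructor
          · rintro ⟨_, ⟨z, hz, rfl⟩, rfl⟩
            exact ⟨z, hz, by simp⟩
          · rintro ⟨z, hz, rfl⟩
            exact ⟨⟨(a : E) * z * (a : E)⁻¹, E₁.mul_mem (E₁.mul_mem a.2 (hK₁E₁ hz))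
              (E₁.inv_mem a.2)⟩, ⟨⟨z, hK₁E₁ hz⟩, hz, Subtype.ext (by simp)⟩, rfl⟩
      _ = K.map (MulAut.conj ((a : E) * x)).toMonoidHom := by
          rw [hK₁, map_map]
          congr 1
          ext y
          simp [mul_assoc]

end Filtered

end Literature.NumberTheory.Automorphic
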